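import Literature.NumberTheory.Transcendental.RoyRankGenericKernels
import Literature.NumberTheory.Transcendental.RoyRankGenericCategory
import Literature.Barriers.Schanuel.AlgebraicIndependenceOfLogarithmsRoyThm1FromLST
import HarnessLib

/-!
# Roy 1992, Theorem 1 over a general field from the Linear Subgroup Theorem on the tangent space

Topic `Literature/NumberTheory/Transcendental` (namespace `Literature.NumberTheory.Transcendental`,
grouping sub-namespace `RoyRank`). Everything here is PROVED; one definition with a body (the
preimage object `RoyRank.Obj.comapObj`); no named facts.

It is the field-generic form (data `(K, F, L, ω)` of `RoyRankGenericDefs.lean`) of the tree's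
complex `Literature.Barriers.Schanuel.Roy1992.exists_admissible_of_obstruction(')` and
`roy1992_thm1_weak_of_linearSubgroupTheorem_weak`
(`AlgebraicIndependenceOfLogarithmsRoyThm1FromLST.lean`): Roy's Theorem 1 is "Theorem 4.1 of
[W3] applied to a linear algebraic group `G_a^{d₀} × G_m^{d₁}`. In our formulation, we identify
the tangent space at the neutral element of this group with `K^{d₀} × K^{d₁}`"
([Roy1992, §1, pp. 24–25], "`K = ℂ` or `ℂ_p`"). Given an obstruction `T_{G'} = E × T` of
Waldschmidt's Theorem 4.1 written on the tangent space — `E ⊆ K^{d₀}` any subspace, `T ⊆ K^{d₁}`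
spanned by its `ℚ`-points (the Lie algebra of a subtorus), `E × T + W ≠ K^{d₀} × K^{d₁}` and the
inequality `(λ + δ₁)(d − n) ≤ (δ − τ) ρ` cross-multiplied in `ℕ` — Roy's admissible map `s` is a
cokernel of his category `𝒞` with kernel `E♭ × T` (`E♭ = K·(E ∩ F^{d₀})`,
[Roy1992, §2 Proposition 1]; tree: `RoyRank.Obj.prop1_ker`), and Roy's inequality with right-hand
side `ρ/(d₀ + d₁ − dim V)` follows by the dimension count of the complex file, word for word:

* `RoyRank.exists_admissible_of_obstruction` — `E` spanned by its `F`-points;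
* `RoyRank.exists_admissible_of_obstruction'` — `E` arbitrary (replace it by `E♭`: the additive
  coordinates of the points of `Y ⊆ F^{d₀} × L^{d₁}` lie in `F`);
* `RoyRank.thm1_zero_of_linearSubgroupTheorem_weak` — for `ω = 0` (no periods, the `p`-adic case:
  `Ω = 0 × ωℚ^{d₁} = 0`, `RoyRank.omega_zero`) the predicate `RoyRank.Thm1 F L 0` follows from the
  period-free Linear Subgroup Theorem on the tangent space, i.e. from the conclusion shape of
  `LinGroupK.weakObstruction_of_zeroEstimate_of_auxiliary` once `λ` is read as
  `dim_ℚ Y − dim_ℚ(Y ∩ T_{G'})`.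

This is the last purely algebraic link of the chain towards the `p`-adic case of Roy's
Theorem 1, `RoyRank.Thm1 (padicQbar p) (RoyPadic.logQSpan p) 0` (the missing input of
`roy1992_padic_thm4_of_waldschmidt`, `RoyPadicRankThm4OfWaldschmidt.lean`).

## References

* [Roy1992] D. Roy, *Matrices whose coefficients are linear forms in logarithms*, J. Number
  Theory 41 (1992) 22–47: Notations p. 24; §1 Theorem 1 (p. 25); §2 Propositions 1–2
  (pp. 27–28).
* [Waldschmidt1988] M. Waldschmidt, *On the transcendence methods of Gel'fond and Schneider in
  several variables*, New Advances in Transcendence Theory (A. Baker ed.), CUP 1988, 375–398: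
  §4 Theorem 4.1 (pp. 382–383); §5 a) Remark (1) (p. 385).
-/

noncomputable section

namespace Literature.NumberTheory.Transcendental.RoyRank

open Module Submodule
open Literature.Barriers.Schanuel (finrank_map_add_finrank_inf_ker)
open Literature.Barriers.Schanuel.Roy1992 (incl incl_apply spanK fPoints mem_fPoints spanK_fPoints_le
  finrank_spanK exists_injective_range_eq_spanK)

variable {K : Type*} [Field K] [CharZero K]
variable {F : IntermediateField ℚ K} {L : Submodule ℚ K}
variable {d₀ d₁ a₀ a₁ : ℕ}

/-! ### `Ω = 0` when `ω = 0` -/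

/-- For `ω = 0` (the `p`-adic case) Roy's `Ω = 0 × ωℚ^{d₁}` is the zero subspace.
[cite: Roy1992, §1 Theorem 1 (p. 25): "`ω = 0` otherwise"] -/
@[simp] theorem omega_zero (d₀ d₁ : ℕ) : Omega (0 : K) d₀ d₁ = ⊥ := by
  rw [Omega, Submodule.span_eq_bot]
  rintro _ ⟨j, rfl⟩
  ext i
  · rfl
  · simp

/-! ### The preimage object of an injective morphism -/

namespace Obj

/-- **The preimage object** `X* = (K^{a₀} × K^{a₁}, i⁻¹(Y), i⁻¹(W), i⁻¹(V))` of an injective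
morphism `i`. [cite: Roy1992, §2 Proposition 1 (p. 27)] -/
def comapObj (X : Obj F L) (i : LinTangent K a₀ a₁ →ₗ[K] LinTangent K X.d₀ X.d₁)
    (hinj : Function.Injective i) (hi : IsBiRational F i) : Obj F L where
  d₀ := a₀
  d₁ := a₁
  Y := X.Y.comap (i.restrictScalars ℚ)
  W := X.W.comap i
  V := X.V.comap i
  finite := by
    haveI := X.finite
    refine Module.Finite.of_injective
      ((i.restrictScalars ℚ).restrict (p := X.Y.comap (i.restrictScalars ℚ)) (q := X.Y)
        fun x hx => hx) ?_
    intro x y hxy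
    apply Subtype.ext
    apply hinj
    have := congrArg Subtype.val hxy
    simpa using this
  isLog := hi.isFLogSubspace_comap hinj X.isLog
  isRat := hi.isFRational_comap hinj X.isRat
  hYV := fun _ hy => X.hYV hy
  hWV := Submodule.comap_mono X.hWV

/-- `(X*, X, i)` is a kernel for every injective morphism `i`. [cite: Roy1992, §2 Proposition 1 (p. 27)] -/
theorem isKerMap_comapObj (X : Obj F L) {i : LinTangent K a₀ a₁ →ₗ[K] LinTangent K X.d₀ X.d₁}
    (hinj : Function.Injective i) (hi : IsBiRational F i) : (X.comapObj i hinj hi).IsKerMap X i :=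
  ⟨hinj, hi, rfl, rfl, rfl⟩

end Obj

/-! ### From an obstruction `E × T` to Roy's admissible map -/

/-- **The dictionary, for one object `X = (K^{d₀} × K^{d₁}, Y, W, V)` and an obstruction whose
vector part is rational over `F`.** Let `E ⊆ K^{d₀}` be spanned by its `F`-points and
`T ⊆ K^{d₁}` by its `ℚ`-points, with `E × T + W ≠ K^{d₀} × K^{d₁}` and
`(λ + δ₁)(d − n) ≤ (δ − τ) ρ` (`λ = dim_ℚ Y − dim_ℚ(Y ∩ (E × T + Ω))`, `δ₁ = d₁ − dim T`,
`δ − τ = d₀ + d₁ − dim(E × T + W)`, `d − n = d₀ + d₁ − dim V`). Then a cokernel `s` of Roy's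
category with `ker s = E × T` is admissible, has `s(W) ≠ K^{d₀'} × K^{d₁'}`, and satisfies Roy's
inequality with right-hand side `ρ/(d − n)`. Port of the complex
`Roy1992.exists_admissible_of_obstruction`. [cite: Roy1992, §1 Theorem 1 (p. 25); §2 Proposition 1 (p. 27)]
[cite: Waldschmidt1988, §4 Theorem 4.1 (pp. 382–383); §5 a) Remark (1) (p. 385)] -/
theorem exists_admissible_of_obstruction (ω : K) {Y : Submodule ℚ (LinTangent K d₀ d₁)}
    {W V : Submodule K (LinTangent K d₀ d₁)} (hfin : FiniteDimensional ℚ Y)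
    (hlog : IsFLogSubspace F L Y) (hrat : IsFRational F W) (hYV : Y ≤ V.restrictScalars ℚ)
    (hWV : W ≤ V) (hV : V ≠ ⊤) (ρ : ℕ) {E : Submodule K (Fin d₀ → K)}
    {T : Submodule K (Fin d₁ → K)} (hE : E ≤ span K {x | x ∈ E ∧ ∀ i, x i ∈ F})
    (hT : T ≤ span K {y | y ∈ T ∧ ∀ j, y j ∈ Set.range (algebraMap ℚ K)})
    (hne : E.prod T ⊔ W ≠ ⊤)
    (hineq : (finrank ℚ Y - finrank ℚ ↥(Y ⊓ ((E.prod T).restrictScalars ℚ ⊔ Omega ω d₀ d₁))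
        + (d₁ - finrank K T)) * (d₀ + d₁ - finrank K V) ≤
      (d₀ + d₁ - finrank K ↥(E.prod T ⊔ W)) * ρ) :
    ∃ (d₀' d₁' : ℕ) (s : LinTangent K d₀ d₁ →ₗ[K] LinTangent K d₀' d₁'), IsAdmissible F s ∧
      W.map s ≠ ⊤ ∧
      ((d₁' : ℝ) - finrank ℚ ↥(Y.map (s.restrictScalars ℚ) ⊓ Omega ω d₀' d₁')
          + finrank ℚ ↥(Y.map (s.restrictScalars ℚ))) /
          ((d₀' : ℝ) + d₁' - finrank K ↥(W.map s)) ≤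
        (ρ : ℝ) / ((d₀ : ℝ) + d₁ - finrank K ↥V) := by
  /- Step 1: `E` and `T` are the ranges of rational injections. -/
  have hE' : spanK K (fPoints (F := F) E) = E := by
    refine le_antisymm (spanK_fPoints_le E) ?_
    rw [spanK]
    refine hE.trans (span_mono fun x hx => ?_)
    have hx' : incl F K d₀ (fun i => ⟨x i, hx.2 i⟩) = x := funext fun i => rfl
    refine ⟨fun i => ⟨x i, hx.2 i⟩, ?_, hx'⟩
    rw [SetLike.mem_coe, mem_fPoints, hx']
    exact hx.1
  have hT' : spanK K (fPoints (F := ℚ) T) = T := by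
    refine le_antisymm (spanK_fPoints_le T) ?_
    rw [spanK]
    refine hT.trans (span_mono fun y hy => ?_)
    choose q hq using hy.2
    have hy' : incl ℚ K d₁ q = y := funext fun j => by rw [incl_apply]; exact hq j
    refine ⟨q, ?_, hy'⟩
    rw [SetLike.mem_coe, mem_fPoints, hy']
    exact hy.1
  obtain ⟨e₀, B₀, he₀, hinj₀, hrange₀⟩ :=
    exists_injective_range_eq_spanK (F := F) (K := K) (fPoints (F := F) E)
  obtain ⟨e₁, B₁, he₁, hinj₁, hrange₁⟩ :=
    exists_injective_range_eq_spanK (F := ℚ) (K := K) (fPoints (F := ℚ) T)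
  have hfinE : finrank K E = e₀ := by
    have := finrank_spanK (K := K) (fPoints (F := F) E)
    rw [hE'] at this
    rw [this, he₀]
  have hfinT : finrank K T = e₁ := by
    have := finrank_spanK (K := K) (fPoints (F := ℚ) T)
    rw [hT'] at this
    rw [this, he₁]
  rw [hE'] at hrange₀
  rw [hT'] at hrange₁
  set i : LinTangent K e₀ e₁ →ₗ[K] LinTangent K d₀ d₁ :=
    (B₀.map (algebraMap F K)).mulVecLin.prodMap (B₁.map (algebraMap ℚ K)).mulVecLin with hi
  have hbi : IsBiRational F i := isBiRational_prodMap B₀ B₁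
  have hinj : Function.Injective i := by
    rw [hi, LinearMap.coe_prodMap]
    exact hinj₀.prodMap hinj₁
  have hrange : LinearMap.range i = E.prod T := by
    rw [hi, LinearMap.range_prodMap, hrange₀, hrange₁]
  /- Step 2: the object, the kernel given by `i`, a cokernel `s` with `ker s = E × T`. -/
  let X : Obj F L := ⟨d₀, d₁, Y, W, V, hfin, hlog, hrat, hYV, hWV⟩
  have hik : (X.comapObj i hinj hbi).IsKerMap X i := X.isKerMap_comapObj hinj hbi
  obtain ⟨B, s, hs, hex⟩ := Obj.prop1_ker (X.comapObj i hinj hbi) X i hik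
  obtain ⟨hd₀, hd₁⟩ := Obj.dims_of_exact hik hs hex
  change e₀ + B.d₀ = d₀ at hd₀
  change e₁ + B.d₁ = d₁ at hd₁
  have hadm : IsAdmissible F s := hs.1
  have hker : LinearMap.ker s = E.prod T := hex.symm.trans hrange
  /- Step 3: dimensions. -/
  set TT : Submodule K (LinTangent K d₀ d₁) := E.prod T with hTT
  have hfinTT : finrank K TT = e₀ + e₁ := by
    rw [← hrange, LinearMap.finrank_range_of_inj hinj, finrank_linTangent]
  haveI : FiniteDimensional ℚ Y := hfin
  have hW' : finrank K (W.map s) + finrank K ↥(W ⊓ TT) = finrank K W := by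
    rw [← hker]
    exact finrank_map_add_finrank_inf_ker s W
  have hsup : finrank K ↥(TT ⊔ W) + finrank K ↥(TT ⊓ W) = finrank K TT + finrank K W :=
    Submodule.finrank_sup_add_finrank_inf_eq TT W
  have hinfc : finrank K ↥(W ⊓ TT) = finrank K ↥(TT ⊓ W) := by rw [inf_comm]
  have hTW_le : finrank K ↥(TT ⊔ W) ≤ d₀ + d₁ := by
    rw [← finrank_linTangent (K := K) d₀ d₁]
    exact Submodule.finrank_le _
  have hTW_lt : finrank K ↥(TT ⊔ W) < d₀ + d₁ := by
    refine lt_of_le_of_ne hTW_le fun heq => hne ?_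
    exact Submodule.eq_top_of_finrank_eq (by rw [finrank_linTangent]; exact heq)
  have hV_lt : finrank K V < d₀ + d₁ := by
    refine lt_of_le_of_ne X.finrank_V_le fun heq => hV ?_
    exact Submodule.eq_top_of_finrank_eq (by rw [finrank_linTangent]; exact heq)
  have he₁ : e₁ ≤ d₁ := by omega
  -- the `ℚ`-side
  set sQ : LinTangent K d₀ d₁ →ₗ[ℚ] LinTangent K B.d₀ B.d₁ := s.restrictScalars ℚ with hsQ
  have hkerQ : LinearMap.ker sQ = TT.restrictScalars ℚ := by
    rw [hsQ, LinearMap.ker_restrictScalars, hker]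
  have hY' : finrank ℚ (Y.map sQ) + finrank ℚ ↥(Y ⊓ TT.restrictScalars ℚ) = finrank ℚ Y := by
    rw [← hkerQ]
    exact finrank_map_add_finrank_inf_ker sQ Y
  set U : Submodule ℚ (LinTangent K d₀ d₁) := Y ⊓ (TT.restrictScalars ℚ ⊔ Omega ω d₀ d₁) with hU
  haveI : FiniteDimensional ℚ U :=
    Module.Finite.of_injective (Submodule.inclusion inf_le_left) (Submodule.inclusion_injective _)
  have hUY : finrank ℚ U ≤ finrank ℚ Y := Submodule.finrank_mono inf_le_left
  have hU' : finrank ℚ (U.map sQ) + finrank ℚ ↥(Y ⊓ TT.restrictScalars ℚ) = finrank ℚ U := by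
    have hUT : U ⊓ LinearMap.ker sQ = Y ⊓ TT.restrictScalars ℚ := by
      rw [hkerQ, hU, inf_assoc,
        (inf_eq_right.2 le_sup_left :
          (TT.restrictScalars ℚ ⊔ Omega ω d₀ d₁) ⊓ TT.restrictScalars ℚ = TT.restrictScalars ℚ)]
    rw [← hUT]
    exact finrank_map_add_finrank_inf_ker sQ U
  have hUmap : U.map sQ ≤ Y.map sQ ⊓ Omega ω B.d₀ B.d₁ := by
    refine le_inf (Submodule.map_mono inf_le_left) ?_
    rintro _ ⟨u, hu, rfl⟩
    obtain ⟨t, ht, w, hw, rfl⟩ := Submodule.mem_sup.1 hu.2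
    have hst : sQ t = 0 := by
      rw [← LinearMap.mem_ker, hkerQ]
      exact ht
    rw [map_add, hst, zero_add]
    exact IsBiRational.map_omega_le hadm.2 ⟨w, hw, rfl⟩
  haveI : FiniteDimensional ℚ ↥(Y.map sQ ⊓ Omega ω B.d₀ B.d₁) :=
    Module.Finite.of_injective (Submodule.inclusion inf_le_left) (Submodule.inclusion_injective _)
  have hfinUmap : finrank ℚ (U.map sQ) ≤ finrank ℚ ↥(Y.map sQ ⊓ Omega ω B.d₀ B.d₁) :=
    Submodule.finrank_mono hUmap
  /- Step 4: the witnesses and the two conclusions. -/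
  refine ⟨B.d₀, B.d₁, s, hadm, ?_, ?_⟩
  · intro htop
    have : finrank K (W.map s) = B.d₀ + B.d₁ := by rw [htop, finrank_top, finrank_linTangent]
    omega
  · have hfinrY : finrank ℚ (Y.map (s.restrictScalars ℚ)) = finrank ℚ (Y.map sQ) := rfl
    have hDpos : (0 : ℝ) < (d₀ : ℝ) + d₁ - finrank K V := by
      have : ((finrank K V : ℕ) : ℝ) < ((d₀ + d₁ : ℕ) : ℝ) := by exact_mod_cast hV_lt
      push_cast at this
      linarith
    have hden : (B.d₀ : ℝ) + B.d₁ - finrank K ↥(W.map s) =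
        ((d₀ + d₁ - finrank K ↥(TT ⊔ W) : ℕ) : ℝ) := by
      rw [Nat.cast_sub hTW_le]
      have e1 : ((finrank K ↥(W.map s) : ℕ) : ℝ) + finrank K ↥(W ⊓ TT) = finrank K W := by
        exact_mod_cast hW'
      have e2 : ((finrank K ↥(TT ⊔ W) : ℕ) : ℝ) + finrank K ↥(TT ⊓ W) =
          finrank K TT + finrank K W := by exact_mod_cast hsup
      have e3 : ((finrank K ↥(W ⊓ TT) : ℕ) : ℝ) = finrank K ↥(TT ⊓ W) := by exact_mod_cast hinfc
      have e4 : ((finrank K TT : ℕ) : ℝ) = e₀ + e₁ := by exact_mod_cast hfinTT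
      have e5 : ((e₀ : ℕ) : ℝ) + B.d₀ = d₀ := by exact_mod_cast hd₀
      have e6 : ((e₁ : ℕ) : ℝ) + B.d₁ = d₁ := by exact_mod_cast hd₁
      push_cast
      linarith
    have hD'pos : (0 : ℝ) < (B.d₀ : ℝ) + B.d₁ - finrank K ↥(W.map s) := by
      rw [hden]
      exact_mod_cast (by omega : 0 < d₀ + d₁ - finrank K ↥(TT ⊔ W))
    have hnum : (B.d₁ : ℝ) - finrank ℚ ↥(Y.map sQ ⊓ Omega ω B.d₀ B.d₁) + finrank ℚ ↥(Y.map sQ) ≤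
        ((finrank ℚ Y - finrank ℚ U + (d₁ - e₁) : ℕ) : ℝ) := by
      rw [Nat.cast_add, Nat.cast_sub hUY, Nat.cast_sub he₁]
      have e1 : ((finrank ℚ ↥(Y.map sQ) : ℕ) : ℝ) + finrank ℚ ↥(Y ⊓ TT.restrictScalars ℚ) =
          finrank ℚ Y := by exact_mod_cast hY'
      have e2 : ((finrank ℚ ↥(U.map sQ) : ℕ) : ℝ) + finrank ℚ ↥(Y ⊓ TT.restrictScalars ℚ) =
          finrank ℚ U := by exact_mod_cast hU'
      have e3 : ((finrank ℚ ↥(U.map sQ) : ℕ) : ℝ) ≤ finrank ℚ ↥(Y.map sQ ⊓ Omega ω B.d₀ B.d₁) := by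
        exact_mod_cast hfinUmap
      have e4 : ((e₁ : ℕ) : ℝ) + B.d₁ = d₁ := by exact_mod_cast hd₁
      linarith
    have hineqR : ((finrank ℚ Y - finrank ℚ U + (d₁ - e₁) : ℕ) : ℝ) *
        ((d₀ : ℝ) + d₁ - finrank K V) ≤
        ((d₀ + d₁ - finrank K ↥(TT ⊔ W) : ℕ) : ℝ) * (ρ : ℝ) := by
      have := hineq
      rw [hfinT] at this
      have h' : (((finrank ℚ Y - finrank ℚ U + (d₁ - e₁)) * (d₀ + d₁ - finrank K V) : ℕ) : ℝ) ≤
          (((d₀ + d₁ - finrank K ↥(TT ⊔ W)) * ρ : ℕ) : ℝ) := by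
        exact_mod_cast this
      have hVle : finrank K V ≤ d₀ + d₁ := X.finrank_V_le
      rw [Nat.cast_mul, Nat.cast_mul, Nat.cast_sub hVle, Nat.cast_add d₀ d₁] at h'
      exact h'
    rw [hfinrY, div_le_div_iff₀ hD'pos hDpos, hden]
    calc ((B.d₁ : ℝ) - finrank ℚ ↥(Y.map sQ ⊓ Omega ω B.d₀ B.d₁) + finrank ℚ ↥(Y.map sQ)) *
          ((d₀ : ℝ) + d₁ - finrank K V)
        ≤ ((finrank ℚ Y - finrank ℚ U + (d₁ - e₁) : ℕ) : ℝ) * ((d₀ : ℝ) + d₁ - finrank K V) :=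
          mul_le_mul_of_nonneg_right hnum hDpos.le
      _ ≤ ((d₀ + d₁ - finrank K ↥(TT ⊔ W) : ℕ) : ℝ) * (ρ : ℝ) := hineqR
      _ = (ρ : ℝ) * ((d₀ + d₁ - finrank K ↥(TT ⊔ W) : ℕ) : ℝ) := mul_comm _ _

/-- **The dictionary, vector part arbitrary.** Same as `exists_admissible_of_obstruction`, but
`E ⊆ K^{d₀}` is NOT assumed rational over `F`: since the first `d₀` coordinates of the points of
`Y ⊆ F^{d₀} × L^{d₁}` lie in `F`, replacing `E` by the `K`-span `E♭` of its `F`-points does not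
change `Y ∩ (E × T + Ω)` and only lowers `dim(E × T + W)`. Port of the complex
`Roy1992.exists_admissible_of_obstruction'`. [cite: Roy1992, §1 Theorem 1 (p. 25)]
[cite: Waldschmidt1988, §4 Theorem 4.1 (pp. 382–383)] -/
theorem exists_admissible_of_obstruction' (ω : K) {Y : Submodule ℚ (LinTangent K d₀ d₁)}
    {W V : Submodule K (LinTangent K d₀ d₁)} (hfin : FiniteDimensional ℚ Y)
    (hlog : IsFLogSubspace F L Y) (hrat : IsFRational F W) (hYV : Y ≤ V.restrictScalars ℚ)
    (hWV : W ≤ V) (hV : V ≠ ⊤) (ρ : ℕ) {E : Submodule K (Fin d₀ → K)}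
    {T : Submodule K (Fin d₁ → K)}
    (hT : T ≤ span K {y | y ∈ T ∧ ∀ j, y j ∈ Set.range (algebraMap ℚ K)})
    (hne : E.prod T ⊔ W ≠ ⊤)
    (hineq : (finrank ℚ Y - finrank ℚ ↥(Y ⊓ ((E.prod T).restrictScalars ℚ ⊔ Omega ω d₀ d₁))
        + (d₁ - finrank K T)) * (d₀ + d₁ - finrank K V) ≤
      (d₀ + d₁ - finrank K ↥(E.prod T ⊔ W)) * ρ) :
    ∃ (d₀' d₁' : ℕ) (s : LinTangent K d₀ d₁ →ₗ[K] LinTangent K d₀' d₁'), IsAdmissible F s ∧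
      W.map s ≠ ⊤ ∧
      ((d₁' : ℝ) - finrank ℚ ↥(Y.map (s.restrictScalars ℚ) ⊓ Omega ω d₀' d₁')
          + finrank ℚ ↥(Y.map (s.restrictScalars ℚ))) /
          ((d₀' : ℝ) + d₁' - finrank K ↥(W.map s)) ≤
        (ρ : ℝ) / ((d₀ : ℝ) + d₁ - finrank K ↥V) := by
  set E' : Submodule K (Fin d₀ → K) := span K {x | x ∈ E ∧ ∀ i, x i ∈ F} with hE'
  have hE'E : E' ≤ E := span_le.2 fun x hx => hx.1
  have hmonoT : E'.prod T ≤ E.prod T := Submodule.prod_mono hE'E le_rfl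
  have hmonoTW : E'.prod T ⊔ W ≤ E.prod T ⊔ W := sup_le_sup_right hmonoT W
  refine exists_admissible_of_obstruction ω hfin hlog hrat hYV hWV hV ρ (E := E') (T := T) ?_ hT
    (fun htop => hne (eq_top_iff.2 (htop.symm.le.trans hmonoTW))) ?_
  · exact span_le.2 fun x hx => subset_span ⟨subset_span hx, hx.2⟩
  · have hYeq : Y ⊓ ((E'.prod T).restrictScalars ℚ ⊔ Omega ω d₀ d₁) =
        Y ⊓ ((E.prod T).restrictScalars ℚ ⊔ Omega ω d₀ d₁) := by
      refine le_antisymm (inf_le_inf_left Y (sup_le_sup_right (fun x hx => hmonoT hx) _)) ?_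
      rintro y ⟨hyY, hy⟩
      obtain ⟨t, ht, w, hw, rfl⟩ := Submodule.mem_sup.1 hy
      have ht' : t.1 ∈ E ∧ t.2 ∈ T := ht
      have hw1 : w.1 = 0 := (mem_omega_iff.1 hw).1
      refine ⟨hyY, Submodule.mem_sup.2 ⟨t, ?_, w, hw, rfl⟩⟩
      refine ⟨subset_span ⟨ht'.1, fun i => ?_⟩, ht'.2⟩
      have halg := (hlog _ hyY).1 i
      rw [Prod.fst_add, hw1, add_zero] at halg
      exact halg
    have hmono : finrank K ↥(E'.prod T ⊔ W) ≤ finrank K ↥(E.prod T ⊔ W) :=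
      Submodule.finrank_mono hmonoTW
    rw [hYeq]
    exact hineq.trans (Nat.mul_le_mul_right _ (Nat.sub_le_sub_left hmono _))

/-! ### Theorem 1 for `ω = 0` from the period-free Linear Subgroup Theorem on the tangent space -/

/-- **Roy 1992, Theorem 1 for the data `(K, F, L, ω = 0)` from the period-free Linear Subgroup
Theorem on the tangent space.** The hypothesis `h` is [Waldschmidt1988, Thm 4.1] for
`G = G_a^{d₀} × G_m^{d₁}` without periods (the `p`-adic situation), the obstruction `G' ≠ G` being
recorded by its Lie algebra `T_{G'} = E × T` (`E` any subspace of `K^{d₀}`, `T` a `ℚ`-rational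
subspace of `K^{d₁}`), `δ > τ` as `E × T + W ≠ ⊤`, and the inequality
`(λ + δ₁)(d − n) ≤ (δ − τ) d₁` with `λ = dim_ℚ Y − dim_ℚ(Y ∩ T_{G'})`, `δ₁ = d₁ − dim T`,
`δ − τ = d₀ + d₁ − dim(T_{G'} + W)`, `d − n = d₀ + d₁ − dim V`, cross-multiplied in `ℕ`. The
conclusion is the predicate `RoyRank.Thm1 F L 0` (for `ω = 0`, `Ω = 0` and Theorem 1 is its
own period-free form). [cite: Roy1992, §1 Theorem 1 (p. 25)] [cite: Waldschmidt1988, §4 Theorem 4.1 (pp. 382–383)] -/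
theorem thm1_zero_of_linearSubgroupTheorem_weak
    (h : ∀ (d₀ d₁ : ℕ) (Y : Submodule ℚ (LinTangent K d₀ d₁)) (W V : Submodule K (LinTangent K d₀ d₁)),
      FiniteDimensional ℚ Y → IsFLogSubspace F L Y → IsFRational F W →
      Y ≤ V.restrictScalars ℚ → W ≤ V → V ≠ ⊤ →
      ∃ (E : Submodule K (Fin d₀ → K)) (T : Submodule K (Fin d₁ → K)),
        T ≤ span K {y | y ∈ T ∧ ∀ j, y j ∈ Set.range (algebraMap ℚ K)} ∧
        E.prod T ⊔ W ≠ ⊤ ∧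
        (finrank ℚ Y - finrank ℚ ↥(Y ⊓ (E.prod T).restrictScalars ℚ) + (d₁ - finrank K T)) *
            (d₀ + d₁ - finrank K V) ≤
          (d₀ + d₁ - finrank K ↥(E.prod T ⊔ W)) * d₁) :
    Thm1 F L (0 : K) := by
  intro d₀ d₁ Y W V hfin hlog hrat hYV hWV hV
  obtain ⟨E, T, hT, hne, hineq⟩ := h d₀ d₁ Y W V hfin hlog hrat hYV hWV hV
  have hineq' : (finrank ℚ Y - finrank ℚ ↥(Y ⊓ ((E.prod T).restrictScalars ℚ ⊔ Omega (0 : K) d₀ d₁))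
      + (d₁ - finrank K T)) * (d₀ + d₁ - finrank K V) ≤ (d₀ + d₁ - finrank K ↥(E.prod T ⊔ W)) * d₁ := by
    rw [omega_zero, sup_bot_eq]
    exact hineq
  obtain ⟨d₀', d₁', s, hadm, hW', hle⟩ :=
    exists_admissible_of_obstruction' (0 : K) hfin hlog hrat hYV hWV hV d₁ hT hne hineq'
  refine ⟨d₀', d₁', s, hadm, hW', ?_⟩
  have e1 : finrank ℚ ↥(Y.map (s.restrictScalars ℚ) ⊓ Omega (0 : K) d₀' d₁') = 0 := by
    rw [omega_zero, inf_bot_eq, finrank_bot]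
  have e2 : finrank ℚ ↥(Y ⊓ Omega (0 : K) d₀ d₁) = 0 := by
    rw [omega_zero, inf_bot_eq, finrank_bot]
  rw [e1, Nat.cast_zero, sub_zero] at hle
  rw [e1, e2, Nat.cast_zero, sub_zero, sub_zero]
  exact hle

end Literature.NumberTheory.Transcendental.RoyRank
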